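import Mathlib
import HarnessLib
import Summits.CriticalPhenomena.PercolationContinuityZ3.Theses.PercTreeValue
import Literature.Probability.Percolation.ClusterBoundary
import Literature.Probability.Percolation.FiniteEnergy
import Literature.Probability.Percolation.RSW
import Literature.Probability.Percolation.ConstrainedClusters

/-!
# `stub_confineProduct` of line `SketchIdeator2` (crux `TetrahedronDisjointCoexistence`,
# stmt-CriticalPhenomena-7798): confinement squaring

Registered stub `stub_confineProduct` (S1) of the lead's skeleton
`Cruxes/TetrahedronDisjointCoexistence/Lines/SketchIdeator2.lean`, landed DEF-FREE over tree
declarations.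

Statement: for `P = bondPercolation (zdGraph 3) p`, regions `R₁, R₂ ⊆ ℤ³` whose LATTICE-edge
supports `edgesTouching Rᵢ ∩ E(ℤ³)` are disjoint, and `x₁ ≠ x₂`,
`P(y₁ ∈ C(x₁) ⊆ R₁) · P(y₂ ∈ C(x₂) ⊆ R₂) ≤ P(x₁ ↔ y₁, x₂ ↔ y₂, x₁ ↮ x₂)`.

Proof.
* The whole-cluster confinement event `Conf(R; x, y) = {y ∈ C(x) ∧ C(x) ⊆ R}` is determined by the
  pairs touching `R` (`determinedBy_confine`, modelled on `determinedBy_clusterIs`): if `ω, ω'`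
  agree on `edgesTouching R` and `C_ω(x) ⊆ R`, then `C_ω(x)` is closed under the open edges of `ω'`,
  so `C_{ω'}(x) ⊆ C_ω(x) ⊆ R`, and symmetrically `C_ω(x) ⊆ C_{ω'}(x)`.
* Hence its preimage under restriction to lattice edges `ρ ω = ω ∩ E` is determined by
  `edgesTouching R ∩ E`, and the two preimages are independent
  (`bondPercolation_real_inter_of_disjoint`, `FiniteEnergy.lean`).
* `P`-a.e. `ω ⊆ E` (`ae_subset_edgeSet`), so `P(ρ⁻¹ S) = P(S)` for every event `S`; `ρ` is
  measurable (`measurable_inter_const`, `ConstrainedClusters.lean`).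
* Pointwise, `ρ⁻¹ Conf(R₁; x₁, y₁) ∩ ρ⁻¹ Conf(R₂; x₂, y₂) ⊆ ρ⁻¹ {x₁ ↔ y₁, x₂ ↔ y₂, x₁ ↮ x₂}`: the
  first open (lattice) edge of an open path `x₁ → x₂` touches `x₁ ∈ C(x₁) ⊆ R₁` and
  `x₁ ∈ C(x₂) ⊆ R₂`, contradicting the disjointness of the lattice-edge supports.
-/

noncomputable section

namespace Summit.CriticalPhenomena.PercolationContinuityZ3.Theorems.TetrahedronDisjointCoexistence

open MeasureTheory
open Literature.Probability.Percolation Literature.Probability.LatticeModels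

variable {V : Type*}

/-- If `ω` and `ω'` agree on the pairs touching `R` and `C_ω(x) ⊆ R`, then `C_{ω'}(x) ⊆ C_ω(x)`:
the cluster `C_ω(x)` is closed under the open edges of `ω'` (an `ω'`-open pair at a vertex of
`C_ω(x) ⊆ R` touches `R`, hence is `ω`-open). -/
theorem openCluster_subset_of_inter_edgesTouching_eq {ω ω' : BondConfig V} {R : Set V} {x : V}
    (h : ω ∩ Literature.Probability.Percolation.edgesTouching R =
      ω' ∩ Literature.Probability.Percolation.edgesTouching R)
    (hR : openCluster ω x ⊆ R) : openCluster ω' x ⊆ openCluster ω x := by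
  -- `C_ω(x)` is closed under the open edges of `ω'`
  have hcl : ∀ a ∈ openCluster ω x, ∀ b, s(a, b) ∈ ω' → a ≠ b → b ∈ openCluster ω x := by
    intro a ha b hab hne
    have ht : s(a, b) ∈ Literature.Probability.Percolation.edgesTouching R :=
      ⟨a, Sym2.mem_mk_left a b, hR ha⟩
    have hω : s(a, b) ∈ ω := by
      have h1 : s(a, b) ∈ ω' ∩ Literature.Probability.Percolation.edgesTouching R := ⟨hab, ht⟩
      rw [← h] at h1
      exact h1.1
    exact SimpleGraph.Reachable.trans ha
      (SimpleGraph.Adj.reachable ((openGraph_adj ω a b).2 ⟨hω, hne⟩))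
  -- hence every `ω'`-open walk from `x` stays in `C_ω(x)` (`walk_end_mem_of_closed`)
  rintro z ⟨w⟩
  exact walk_end_mem_of_closed hcl w (mem_openCluster_self ω x) z (SimpleGraph.Walk.end_mem_support w)

/-- **The whole-cluster confinement event `{y ∈ C(x) ∧ C(x) ⊆ R}` is determined by the pairs
touching `R`** (for all configurations, lattice or not). -/
theorem determinedBy_confine (R : Set V) (x y : V) :
    DeterminedBy {ω : BondConfig V | y ∈ openCluster ω x ∧ openCluster ω x ⊆ R}
      (Literature.Probability.Percolation.edgesTouching R) := by
  rw [determinedBy_iff]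
  have key : ∀ ω ω' : BondConfig V,
      ω ∩ Literature.Probability.Percolation.edgesTouching R =
        ω' ∩ Literature.Probability.Percolation.edgesTouching R →
      ω ∈ {ω : BondConfig V | y ∈ openCluster ω x ∧ openCluster ω x ⊆ R} →
      ω' ∈ {ω : BondConfig V | y ∈ openCluster ω x ∧ openCluster ω x ⊆ R} := by
    intro ω ω' h hω
    obtain ⟨hy, hR⟩ := hω
    have h1 : openCluster ω' x ⊆ openCluster ω x :=
      openCluster_subset_of_inter_edgesTouching_eq h hR
    have h2 : openCluster ω x ⊆ openCluster ω' x :=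
      openCluster_subset_of_inter_edgesTouching_eq h.symm (h1.trans hR)
    exact ⟨h2 hy, h1.trans hR⟩
  intro ω ω' h
  exact ⟨key ω ω' h, key ω' ω h.symm⟩

/-- The preimage under restriction to `E` of an event determined by `F` is determined by `F ∩ E`
(`(ω ∩ E) ∩ F = ω ∩ (F ∩ E)`). -/
theorem determinedBy_preimage_inter_of {A : Set (BondConfig V)} {F : Set (Sym2 V)}
    (E : Set (Sym2 V)) (hA : DeterminedBy A F) :
    DeterminedBy ((fun ω : BondConfig V => ω ∩ E) ⁻¹' A) (F ∩ E) := by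
  rw [determinedBy_iff] at hA ⊢
  intro ω ω' h
  simp only [Set.mem_preimage]
  refine hA (ω ∩ E) (ω' ∩ E) ?_
  rw [Set.inter_assoc, Set.inter_assoc, Set.inter_comm E F, h]

/-- The confinement event is measurable (`V` countable):
`{y ∈ C(x) ∧ C(x) ⊆ R} = {x ↔ y} ∩ ⋂_{z ∉ R} {x ↔ z}ᶜ`. -/
theorem measurableSet_confine [Countable V] (R : Set V) (x y : V) :
    MeasurableSet {ω : BondConfig V | y ∈ openCluster ω x ∧ openCluster ω x ⊆ R} := by
  have h : {ω : BondConfig V | y ∈ openCluster ω x ∧ openCluster ω x ⊆ R} =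
      openConn x y ∩ ⋂ z ∈ Rᶜ, (openConn x z)ᶜ := by
    ext ω
    simp only [openCluster, openConn, Set.subset_def, Set.mem_setOf_eq, Set.mem_inter_iff,
      Set.mem_iInter, Set.mem_compl_iff]
    exact ⟨fun ⟨hy, h⟩ => ⟨hy, fun z hz hr => hz (h z hr)⟩,
      fun ⟨hy, h⟩ => ⟨hy, fun z hr => by_contra fun hz => h z hz hr⟩⟩
  rw [h]
  exact (measurableSet_openConn_holds x y).inter
    (MeasurableSet.biInter (Set.to_countable _) fun z _ => (measurableSet_openConn_holds x z).compl)

/-- Under `P_p`, restriction to the edges of `G` does not change probabilities: `P_p`-a.e.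
`ω ⊆ E(G)` (`ae_subset_edgeSet`), and there `ω ∩ E(G) = ω`. -/
theorem real_preimage_inter_edgeSet [Countable V] (G : SimpleGraph V) (p : unitInterval)
    (S : Set (BondConfig V)) :
    (bondPercolation G p).real ((fun ω : BondConfig V => ω ∩ G.edgeSet) ⁻¹' S) =
      (bondPercolation G p).real S := by
  refine measureReal_congr ?_
  rw [Filter.eventuallyEq_set]
  filter_upwards [ae_subset_edgeSet G p] with ω hω
  show ω ∩ G.edgeSet ∈ S ↔ ω ∈ S
  rw [Set.inter_eq_self_of_subset_left hω]

/-- **Pointwise heart.** On configurations restricted to the edges of `G`, two whole-cluster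
confinement events whose lattice-edge supports are disjoint force disjoint coexistence:
`x₁ ↔ y₁`, `x₂ ↔ y₂` and `x₁ ↮ x₂` — the first open edge of an open path `x₁ → x₂` is an edge of
`G` touching `x₁ ∈ C(x₁) ⊆ R₁` and `x₁ ∈ C(x₂) ⊆ R₂`. -/
theorem preimage_confine_inter_subset (G : SimpleGraph V) {R₁ R₂ : Set V} {x₁ x₂ : V}
    (y₁ y₂ : V) (hx : x₁ ≠ x₂)
    (hdisj : Disjoint (Literature.Probability.Percolation.edgesTouching R₁ ∩ G.edgeSet)
      (Literature.Probability.Percolation.edgesTouching R₂ ∩ G.edgeSet)) :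
    (fun ω : BondConfig V => ω ∩ G.edgeSet) ⁻¹'
          {ω : BondConfig V | y₁ ∈ openCluster ω x₁ ∧ openCluster ω x₁ ⊆ R₁} ∩
        (fun ω : BondConfig V => ω ∩ G.edgeSet) ⁻¹'
          {ω : BondConfig V | y₂ ∈ openCluster ω x₂ ∧ openCluster ω x₂ ⊆ R₂} ⊆
      (fun ω : BondConfig V => ω ∩ G.edgeSet) ⁻¹'
        (openConn x₁ y₁ ∩ openConn x₂ y₂ ∩ (openConn x₁ x₂)ᶜ) := by
  intro ω hω
  simp only [Set.mem_inter_iff, Set.mem_preimage, Set.mem_setOf_eq, Set.mem_compl_iff] at hω ⊢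
  obtain ⟨⟨hy₁, hR₁⟩, hy₂, hR₂⟩ := hω
  refine ⟨⟨hy₁, hy₂⟩, fun h => ?_⟩
  have h₁ : x₁ ∈ R₁ := hR₁ (mem_openCluster_self _ x₁)
  have h₂ : x₁ ∈ R₂ :=
    hR₂ (show x₁ ∈ openCluster (ω ∩ G.edgeSet) x₂ from SimpleGraph.Reachable.symm h)
  obtain ⟨w⟩ := (show (openGraph (ω ∩ G.edgeSet)).Reachable x₁ x₂ from h)
  cases w with
  | nil => exact hx rfl
  | cons hadj _ =>
    obtain ⟨he, -⟩ := (openGraph_adj _ _ _).1 hadj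
    exact Set.disjoint_left.1 hdisj ⟨⟨x₁, Sym2.mem_mk_left _ _, h₁⟩, he.2⟩
      ⟨⟨x₁, Sym2.mem_mk_left _ _, h₂⟩, he.2⟩

/-- **S1 — confinement squaring.** If the lattice-edge supports of `R₁` and `R₂` are disjoint and
`x₁ ≠ x₂`, then `P(y₁ ∈ C(x₁) ⊆ R₁) · P(y₂ ∈ C(x₂) ⊆ R₂) ≤ P(x₁ ↔ y₁, x₂ ↔ y₂, x₁ ↮ x₂)` for
`P = bondPercolation (zdGraph 3) p`: the two confinement events, pulled back along restriction to
lattice edges (an a.s. identity), are determined by disjoint edge sets, hence independent, and their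
intersection lies in the disjoint-coexistence event. -/
theorem stub_confineProduct (p : unitInterval) (R₁ R₂ : Set (Site 3)) (x₁ y₁ x₂ y₂ : Site 3)
    (hx : x₁ ≠ x₂)
    (hdisj : Disjoint (edgesTouching R₁ ∩ (zdGraph 3).edgeSet) (edgesTouching R₂ ∩ (zdGraph 3).edgeSet)) :
    (bondPercolation (zdGraph 3) p).real {ω | y₁ ∈ openCluster ω x₁ ∧ openCluster ω x₁ ⊆ R₁} *
        (bondPercolation (zdGraph 3) p).real {ω | y₂ ∈ openCluster ω x₂ ∧ openCluster ω x₂ ⊆ R₂} ≤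
      (bondPercolation (zdGraph 3) p).real
        (openConn x₁ y₁ ∩ openConn x₂ y₂ ∩ (openConn x₁ x₂)ᶜ) := by
  have hA₁ := determinedBy_preimage_inter_of (zdGraph 3).edgeSet (determinedBy_confine R₁ x₁ y₁)
  have hA₂ := determinedBy_preimage_inter_of (zdGraph 3).edgeSet (determinedBy_confine R₂ x₂ y₂)
  have hm₁ := (measurableSet_confine R₁ x₁ y₁).preimage (measurable_inter_const (zdGraph 3).edgeSet)
  have hm₂ := (measurableSet_confine R₂ x₂ y₂).preimage (measurable_inter_const (zdGraph 3).edgeSet)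
  have hind := bondPercolation_real_inter_of_disjoint (zdGraph 3) p hdisj hA₁ hA₂ hm₁ hm₂
  have key := measureReal_mono (μ := bondPercolation (zdGraph 3) p)
    (preimage_confine_inter_subset (zdGraph 3) y₁ y₂ hx hdisj)
  rw [hind, real_preimage_inter_edgeSet, real_preimage_inter_edgeSet,
    real_preimage_inter_edgeSet] at key
  exact key

end Summit.CriticalPhenomena.PercolationContinuityZ3.Theorems.TetrahedronDisjointCoexistence

end
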